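import Mathlib
import HarnessLib
import HarnessLib.Audit
import Summits.QuantumFields.Statement
import Literature.MathematicalPhysics.QuantumLattice.LatticeGaugeDLR
import Literature.MathematicalPhysics.QuantumLattice.WilsonLoops
import Literature.MathematicalPhysics.QuantumLattice.GaugeGroups
import Literature.MathematicalPhysics.QuantumLattice.GaugeGroupsProofs
import HarnessLib.Audit.Status.Attr

/-!
Route: WeakCouplingMasslessPhase

# Route WeakCouplingMasslessPhase — SU(N)4 deconfines at weak coupling and deconfined means no
uniform lattice gap, so the lattice leg of YangMills fails

REFUTATION route (concludes `¬ YangMills`). X = K1a ∧ K1b, "it suffices to show X to refute the hub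
statement":
K1a (WeakCouplingPerimeterLawD4, the Patrascioiu–Seiler zero-temperature deconfinement conjecture,
lattice form): for some N ≥ 2 and
EVERY faithful continuous unitary lattice action r of SU(N), above a threshold β_c(r) every
infinite-volume torus limit state of the
four-dimensional Wilson theory has a perimeter law for the fundamental Wilson loop. K1b
(DeconfinedIsMassless, the bridge): for every
N ≥ 2 and faithful r there is a fixed pair of gauge-invariant bounded local observables whose
connected torus time-correlation admits NO
volume-uniform bound C·e^(−m n) (0 ≤ n ≤ S, all large S) at any rate m > 0 at any β > 0 at which all
torus limit states are deconfined.
Since the hub statement demands, at G = SU(N), a scheme with β_k → ∞ (HasWeakCouplingLimit) and a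
volume-uniform lattice gap for ALL
observable pairs eventually in k (HasLatticeMassGap), X contradicts it at the first k with β_k >
max(β_c(r), 0): no continuum or OS step
is needed. Realises the mwave sketch weak-coupling-massless-phase-negation (readers PASS,
VERDICT.json).
Lean: `WeakCouplingPerimeterLawD4 ∧ DeconfinedIsMassless`

## Assembly
Pure logic plus two tree theorems (the glue `closes`, 15 lines, certified): from K1a get N, β_c;
`isCompactSimpleLieGroup_specialUnitaryGroup
isSimpleCompactGroup_specialUnitaryGroup_holds` discharges the hypothesis of YangMills at G = SU(N)
(the Statement's `letI borel` instances
are the tree's global SU(N) instances by `rfl`); YangMills then yields r, sch with `Tendsto sch.β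
atTop atTop`, Δ > 0 and `HasLatticeMassGap r
sch Δ`; K1b yields the pair (A, B) for (N, r); HasLatticeMassGap gives C and an eventual-in-k
uniform bound at rate Δ·a_k > 0 (`sch.a_pos`);
pick k in the intersection of that eventuality with `sch.β k > max β_c 0`; K1a makes every torus
limit state at β = sch.β k deconfined, and
K1b at β = sch.β k, m = Δ·a_k, S₀ = sch.L k is contradicted. The deciding theorem is `closes`
(refutation form); the Assembly item records the same implication.

Rationale: WHY THIS LINE. The hub statement is lattice-anchored: its last conjunct `HasLatticeMassGap r sch Δ`
is volume-uniform exponential clustering of every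
pair of gauge-invariant local lattice observables along a scheme with `sch.β k → ∞`, for EVERY
compact simple G — so a single group
(SU(N)) with a massless weak-coupling lattice phase refutes it outright. Patrascioiu–Seiler
(arXiv:math-ph/9903038 §3, arXiv:hep-th/0312015
p.3) conjecture exactly such a phase: SU(N)₄ deconfines at weak coupling like U(1)₄ (Guth 1980 /
FrohlichSpencerCMP1982, tree fact
`FrohlichSpencerU1PerimeterLawD4`) and like SU(N) at every finite temperature (BorgsSeiler1983,
PROVED in tree as
`Literature.Barriers.QuantumFields.isotropic_specialUnitary_holds`). The bridge K1b is the
contrapositive of "a uniform lattice gap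
confines", which Chatterjee (arXiv:2006.16229 Thm 2.2/2.4) proves under decay for ARBITRARY boundary
conditions via unbroken centre
symmetry of DLR states, leaving the torus/two-point form open (p.7). Imported areas: statistical
mechanics of lattice gauge theories
(DLR equations, centre symmetry, reflection positivity / infrared bounds); no continuum QFT at all.
No prior route on this hub concludes
¬YangMills (29 Theses, all positive; ThermalRuler uses the same Borgs–Seiler/Chatterjee inputs in
the opposite direction), and the
negatives index (7 statements) contains nothing about confinement vs clustering.

RANKED CRUXES. #2 WeakCouplingPerimeterLawD4 (crux) — Patrascioiu–Seiler zero-temperature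
deconfinement: ∃ N ≥ 2 such that for every faithful continuous unitary representation r of SU(N)
(Wilson action in r) there is β_c(r) with: for all β > β_c(r), every μ ∈
infiniteVolumeLimitPoints(r.ρ, β) (d = 4) satisfies HasPerimeterLaw μ χ_fund, χ_fund(g) = (1/N) Re
tr g (sketch item K1a; deciding crux). [difficulty: open-problem] (why it might fail: Consensus and
numerics say SU(2), SU(3) (fundamental Wilson action) have no bulk deconfining transition in d = 4
and the thermal β_c(N_t) follows two-loop scaling to ∞ (hep-lat/0307017, hep-lat/0502003 §10); the
SIGNED bound also asserts positivity of large loops.) [arXiv:math-ph/9903038, arXiv:hep-th/0312015,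
arXiv:hep-lat/0502003, arXiv:hep-lat/0307017, BorgsSeiler1983, FrohlichSpencerCMP1982]
#3 DeconfinedIsMassless (crux) — deconfined ⇒ massless on the lattice: for all N ≥ 2 and every
faithful r there exist gauge-invariant bounded local observables A, B (YMSpecies; intended: the
(0,1)-plaquette with itself) such that for every β > 0 at which ALL torus limit states of the
r-theory have the fundamental perimeter law, there are NO C, m > 0, S₀ with |latticeConnectedCorr
r.ρ β (2S+1) A B n| ≤ C e^(−m n) for all S ≥ S₀ and 0 ≤ n ≤ S (sketch item K1b, torus form;
contrapositive: a volume-uniform plaquette-channel lattice gap confines). [difficulty: XL] (why it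
might fail: A gapped yet deconfined (Higgs-like / topologically ordered) weak-coupling phase of pure
SU(N)₄ for some faithful action r would be a counterexample — finite gauge groups do exactly this
(ZnHiggsPhaseD4, file DiscreteSubgroupFreezing); nothing printed excludes it for connected G.)
[arXiv:2006.16229, arXiv:2202.10375, arXiv:1803.01950]

TWO-LAYER PLAN. Foreseen glued splits (registered as birth skeletons, not filed as items):
WeakCouplingPerimeterLawD4 ⇐ stub_deconfinedSeed (one deconfined
coupling β₀(r) > 0 per faithful action) → stub_perimeterMonotone (the all-limit-states perimeter law
propagates from β₀ to every β ≥ β₀;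
implied by torus-level Griffiths monotonicity of Wilson loops in β, open for SU(N)); alternative
line = the thermal ladder (an N_t-UNIFORM
Borgs–Seiler threshold ⇒ zero-temperature deconfinement). DeconfinedIsMassless ⇐
stub_centreUnbroken_of_torusClustering (uniform odd-torus
clustering of the plaquette pair at β > 0 ⇒ every DLR state is invariant under the slab centre
transformation — the new bridge; must use
connectedness of SU(N)) → stub_not_perimeter_of_centreUnbroken (Chatterjee Thm 2.2 in torus-primary
form: unbroken centre ⇒ no perimeter law
in any torus limit state, these being DLR states by
`mem_ymGibbsMeasures_of_mem_infiniteVolumeLimitPoints_holds`).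

KILL CRITERIA. A proof of `¬ WeakCouplingPerimeterLawD4` — e.g. an area law (or just failure of the
signed perimeter bound in ONE torus limit state at
arbitrarily large β) for every N ≥ 2 and some faithful r — closes the route outright (`close
--reason refuted:WeakCouplingPerimeterLawD4`);
so does any proof of YangMills itself or of `LatticeMassGapAllCouplings` at G = SU(N). A proof of `¬
DeconfinedIsMassless` (a gapped deconfined
SU(N)₄ phase) forces a pivot to the flux/'t Hooft-loop form of the bridge (electric-flux free energy
instead of plaquette clustering) or
retirement. A disproof of stub_perimeterMonotone alone only kills the seed-and-propagate line, not
the crux.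

NOT DECOMPOSED YET. The N_t-uniform thermal threshold (ceiling lift of the Borgs–Seiler ladder), the
thermal → zero-temperature passage (Polyakov long-range
order at all N_t ⇒ perimeter law of symmetric-torus limit states), translation invariance /
reflection positivity of odd-torus limit states,
and the choice N = 2 vs general N are deliberately left to the lines (layer 2). No definition items:
`CentreUnbroken` and the slab centre
transformation are defined inside the K1b skeleton over `ymGibbsMeasures` and become a Literature
definition request only if a prover needs
them shared.

CHEAPEST FALSIFIER. For K1a: none that is a lookup — no theorem decides the weak-coupling phase of
any non-abelian four-dimensional lattice gauge theory either
way (checked: `lean search`, corpus, galaxy); the cheapest informative check is numerical and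
adverse (Creutz ratios / β_c(N_t) scaling,
hep-lat/0502003). For K1b: the finite-subgroup analogue is FALSE (ℤ_n ⊂ SU(N): perimeter law AND
clustering at weak coupling,
`Literature.Barriers.QuantumFields.ZnHiggsPhaseD4` (DiscreteSubgroupFreezing.lean),
arXiv:2202.10375) — run by inspection: the crux is typed at connected SU(N) only,
so the refuter's first move is to look for a faithful r of SU(N) with a first-order bulk line into a
gapped deconfined phase (Bhanot–Creutz
fundamental–adjoint plane; none known to deconfine). For the glue: certified (`ledger route check
--native … --refutation`, closes OK).

NUMBERS. Borgs–Seiler thermal window: deconfinement on ℤ³ × ℤ_(L₀) for J_E ≥ c·χ(1)·L₀ (LINEAR in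
L₀; BorgsSeiler1983 Lemma III.6 / Thm III.7, tree
`FiniteTemperatureDeconfinement`); two-loop scaling would need β_c(L₀) ~ (11 N / 24π²) log L₀.
Fröhlich–Spencer: U(1)₄ perimeter law for
β > β₁ (Villain; FrohlichSpencerCMP1982 §2.10). Osterwalder–Seiler: area law and clustering for all
compact G at small β > 0 (so β_c(r) > 0).

DEFINITION REQUESTS. None at open. If the K1b line is staffed: `CentreUnbroken ρ β` (slab centre
invariance of all `ymGibbsMeasures ρ β`, Chatterjee 2021 Def. 2.1)
as `Literature/MathematicalPhysics/QuantumLattice` vocabulary, and a vendored named fact for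
Chatterjee 2021 Thm 2.2 / Thm 2.4 over `HasStrongExpDecay`.

Novelty: Searches (2026-08-17): lit search --hybrid ×5 ("Patrascioiu Seiler zero temperature deconfinement
SU(2) … perimeter law weak coupling" → Montvay–Münster pp.138–164, Greensite pp.93/160, Creutz;
"unbroken center symmetry confinement exponential decay arbitrary boundary conditions" → Greensite
pp.41–48, Montvay–Münster; "Borgs Seiler finite temperature … proportional to temporal extent" →
Kapusta–Gale p.163, Montvay–Münster p.140; "monotonicity of Wilson loop expectation in beta
Griffiths non-abelian" → Montvay–Münster p.138, Greensite p.115 — no non-abelian Griffiths theorem),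
lit vsearch ×1 (K1b in prose → Greensite pp.13–22, Montvay–Münster p.138: heuristics only), lit
galaxy search ×5 ("Patrascioiu" --star pdf: 8 reference-list/junk hits; "deconfining phase
transition at zero temperature|no deconfining transition|deconfined phase at zero temperature"
--star all: 2 junk hits; "Patrascioiu|super-instanton|deconfining transition", "Borgs and
Seiler|Borgs-Seiler", "unbroken center symmetry|mechanism for quark confinement": galaxyd saturated,
queued > 90 s), plus the sketch seat's searches of the same day (hybrid ×3, vsearch ×1, galaxy ×3
all null; lit read of math-ph/9903038, hep-th/0312015, hep-lat/0307017, hep-lat/0502003, 2006.16229,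
Greensite pp.30–52); lean search/dedup: `exact?` fails on both cruxes against Mathlib + 573
gauge-theory Literature/Barriers/Theses modules; ledger negatives (7): none related.
Nearest prior art found: [corpus:paper:arxiv-math-ph_9903038 p.8] an  [refs: paper:arxiv-math-ph_9903038, paper:arxiv-hep-th_0312015, paper:arxiv-2006.16229]

Barriers (technique_class: lattice-deconfinement, centre-symmetry-dlr, rp-infrared): - technique_class: lattice-deconfinement, centre-symmetry-dlr, rp-infrared
- Literature.Barriers.QuantumFields.AbelianDeconfinementD4: outside — it refutes group-BLIND
confinement classes via U(1)₄; K1a asserts deconfinement for one group and is the non-abelian twin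
of the barrier's own input (`AbelianDeconfinementD4_of_frohlichSpencer` is K1a's BC5 sibling rung).
- Literature.Barriers.QuantumFields.MigdalKadanoffGroupBlindness: outside — no group-blind recursion
is used; both cruxes are typed at SU(N) and K1b must use connectedness.
- Literature.Barriers.QuantumFields.NonabelianCoulombPhaseD5: outside — it kills dimension-blind
confinement arguments; this route argues FOR a Coulomb-like phase in d = 4 and is d-specific; honest
line: the barrier's evasions_known record the consensus that d = 4 confines at all couplings — the
route does not evade that consensus; the bet is Patrascioiu–Seiler.
- Literature.Barriers.QuantumFields.FiniteTemperatureDeconfinement: not an obstruction but the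
ladder's proved rung (Borgs–Seiler, linear thermal window); its ceiling (window linear in L₀ because
the continuum limit is not controlled, BS83 p.359) is exactly what K1a must lift — declared as the
crux, disposition FRONTIER expected.
- Literature.Barriers.QuantumFields.ZnHiggsPhaseD4: (file DiscreteSubgroupFreezing; PROVED in tree)
K1b sits inside its danger zone (finite G: perimeter law AND massive/clustering at weak coupling) —
evaded only by typing K1b at connected G = SU(N); any proof mus

History (route lifecycle, newest last):
- 2026-08-27T13:04:11Z · DORMANT — reconciler: no traction for 9.7 d (last activity item-evidence-added at 2026-08-17T19:17:48Z); parked, not closed — `ledger route dormant route-QuantumFields-We (operator:999:3575998)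
- 2026-08-27T16:50:12Z · REACTIVATED — reconciler: reactivated — activity item-evidence-added at 2026-08-27T15:22:48Z after parking at 2026-08-27T13:04:11Z (operator:999:3963844)

sub-problem: YangMills · status: open · opened planner-type-ee1b64c980-0 2026-08-17T18:42:55Z · rev 0 · ledger route-QuantumFields-WeakCouplingMasslessPhase
GENERATED by the gate from the ledger (D-0016/17). Provers cite these decls: `theorem foo : Summit.QuantumFields.YangMills.Theses.WeakCouplingMasslessPhase.<Decl> := …` in Summits/QuantumFields/YangMills/Theorems/<Name>.lean.
-/

namespace Summit.QuantumFields.YangMills.Theses.WeakCouplingMasslessPhase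

open scoped BigOperators Topology Manifold Classical MeasureTheory ProbabilityTheory Matrix InnerProductSpace ComplexConjugate ContinuousMap
open Filter Set Function TopologicalSpace MeasureTheory

attribute [summit_statement] _root_.YangMills

/-- item stmt-QuantumFields-19520 · crux · rank 2 · open · by planner
why it might fail: Consensus and numerics say SU(2), SU(3) (fundamental Wilson action) have no bulk deconfining transition in d = 4 and the thermal β_c(N_t) follows two-loop scaling to ∞ (hep-lat/0307017, hep-lat/0502003 §10); the SIGNED bound also asserts positivity of large loops.
sources: arXiv:math-ph/9903038, arXiv:hep-th/0312015, arXiv:hep-lat/0502003, arXiv:hep-lat/0307017, BorgsSeiler1983, FrohlichSpencerCMP1982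
[crux] Patrascioiu–Seiler zero-temperature deconfinement: ∃ N ≥ 2 such that for every faithful
continuous unitary representation r of SU(N) (Wilson action in r) there is β_c(r) with: for all β >
β_c(r), every μ ∈ infiniteVolumeLimitPoints(r.ρ, β) (d = 4) satisfies HasPerimeterLaw μ χ_fund,
χ_fund(g) = (1/N) Re tr g (sketch item K1a; deciding crux). [difficulty: open-problem] -/
@[route_item "route-QuantumFields-WeakCouplingMasslessPhase", crux]
def WeakCouplingPerimeterLawD4 : Prop :=
  ∃ N : ℕ, 2 ≤ N ∧ ∀ r : Literature.MathematicalPhysics.QuantumFieldTheory.LatticeRep (Matrix.specialUnitaryGroup (Fin N) ℂ), ∃ βc : ℝ, ∀ β : ℝ, βc < β → ∀ μ ∈ Literature.MathematicalPhysics.QuantumLattice.infiniteVolumeLimitPoints (d := 4) r.ρ β, Literature.MathematicalPhysics.QuantumLattice.HasPerimeterLaw μ (fun g => Literature.MathematicalPhysics.QuantumLattice.normalisedCharacter N (Literature.MathematicalPhysics.QuantumLattice.fundamentalRep (Fin N) g))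

/-- item stmt-QuantumFields-19521 · crux · rank 3 · open · by planner
why it might fail: A gapped yet deconfined (Higgs-like / topologically ordered) weak-coupling phase of pure SU(N)₄ for some faithful action r would be a counterexample — finite gauge groups do exactly this (ZnHiggsPhaseD4, file DiscreteSubgroupFreezing); nothing printed excludes it for connected G.
sources: arXiv:2006.16229, arXiv:2202.10375, arXiv:1803.01950
[crux] deconfined ⇒ massless on the lattice: for all N ≥ 2 and every faithful r there exist
gauge-invariant bounded local observables A, B (YMSpecies; intended: the (0,1)-plaquette with
itself) such that for every β > 0 at which ALL torus limit states of the r-theory have the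
fundamental perimeter law, there are NO C, m > 0, S₀ with |latticeConnectedCorr r.ρ β (2S+1) A B n|
≤ C e^(−m n) for all S ≥ S₀ and 0 ≤ n ≤ S (sketch item K1b, torus form; contrapositive: a
volume-uniform plaquette-channel lattice gap confines). [difficulty: XL] -/
@[route_item "route-QuantumFields-WeakCouplingMasslessPhase", crux]
def DeconfinedIsMassless : Prop :=
  ∀ N : ℕ, 2 ≤ N → ∀ r : Literature.MathematicalPhysics.QuantumFieldTheory.LatticeRep (Matrix.specialUnitaryGroup (Fin N) ℂ), ∃ A B : Literature.MathematicalPhysics.QuantumFieldTheory.YMSpecies (Matrix.specialUnitaryGroup (Fin N) ℂ), ∀ β : ℝ, 0 < β → (∀ μ ∈ Literature.MathematicalPhysics.QuantumLattice.infiniteVolumeLimitPoints (d := 4) r.ρ β, Literature.MathematicalPhysics.QuantumLattice.HasPerimeterLaw μ (fun g => Literature.MathematicalPhysics.QuantumLattice.normalisedCharacter N (Literature.MathematicalPhysics.QuantumLattice.fundamentalRep (Fin N) g))) → ¬ ∃ (C m : ℝ) (S₀ : ℕ), 0 < m ∧ ∀ S : ℕ, S₀ ≤ S → ∀ n : ℕ,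 n ≤ S → |Literature.MathematicalPhysics.QuantumFieldTheory.latticeConnectedCorr r.ρ β (2 * S + 1) A.F B.F n| ≤ C * Real.exp (-(m * n))

/-- item stmt-QuantumFields-19522 · assembly · rank 1 · closed · proved by Summit.QuantumFields.YangMills.Theorems.WeakCouplingMasslessPhase.assembly_proof (prover) · by planner
sources: arXiv:math-ph/9903038, arXiv:2006.16229
[assembly] WeakCouplingPerimeterLawD4 → DeconfinedIsMassless → ¬ YangMills (the refutation: both
cruxes contradict the lattice leg HasLatticeMassGap of the hub statement at G = SU(N) along any
scheme with β_k → ∞). -/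
@[route_item "route-QuantumFields-WeakCouplingMasslessPhase"]
def Assembly : Prop :=
  WeakCouplingPerimeterLawD4 → DeconfinedIsMassless → ¬ YangMills

-- `Assembly` holds: proved by `Summit.QuantumFields.YangMills.Theorems.WeakCouplingMasslessPhase.assembly_proof` (its module imports this route file, so no `_holds` link can be stated here).

/-! D-0027 §2.1 — DECIDING THEOREM (planner-authored via `route open/edit --closes-file`; by planner-type-ee1b64c980-0 2026-08-17T18:42:55Z):
its hypotheses are this route's items and its conclusion the sub-problem Statement (glue_lint), and it elaborates with this file. -/

@[closes "route-QuantumFields-WeakCouplingMasslessPhase"] theorem closes (h₁ : WeakCouplingPerimeterLawD4) (h₂ : DeconfinedIsMassless) : ¬ YangMills := by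
  intro hYM
  obtain ⟨N, hN, hper⟩ := h₁
  obtain ⟨r, sch, T, hβ, -, -, -, Δ, hΔ, -, hgap⟩ :=
    hYM (Matrix.specialUnitaryGroup (Fin N) ℂ)
      (Literature.MathematicalPhysics.QuantumFieldTheory.isCompactSimpleLieGroup_specialUnitaryGroup
        Literature.MathematicalPhysics.QuantumLattice.isSimpleCompactGroup_specialUnitaryGroup_holds hN)
  obtain ⟨βc, hβc⟩ := hper r
  obtain ⟨A, B, hAB⟩ := h₂ N hN r
  obtain ⟨C, hC⟩ := hgap A B
  obtain ⟨k, hk, hkβ⟩ := (hC.and (hβ.eventually (eventually_gt_atTop (max βc 0)))).exists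
  refine hAB (sch.β k) (lt_of_le_of_lt (le_max_right _ _) hkβ)
    (fun μ hμ => hβc _ (lt_of_le_of_lt (le_max_left _ _) hkβ) μ hμ)
    ⟨C, Δ * sch.a k, sch.L k, mul_pos hΔ (sch.a_pos k), fun S hS n hn => ?_⟩
  simpa [mul_assoc] using hk S hS n hn

end Summit.QuantumFields.YangMills.Theses.WeakCouplingMasslessPhase
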